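import Mathlib
import HarnessLib
import Summits.KontsevichZagierPeriods.Zeta5Search.Denom.TwoTaleL720Exponent
import Summits.KontsevichZagierPeriods.Zeta5Search.Denom.TwoTaleL720LevelSteps

/-!
# TwoTaleL720Levels — prime-by-prime API of the L(7/20) saving product `Φₙ` and the bridge from level divisibilities to `InclusionL720`

HONEST FRAMING: systematic search; no irrationality claim unless certified.

Cell pub-zeta5 (measure-opt g0), rung L(7/20) of the two-tale ladder; the L(7/20) clone of fam-denom's `TwoTaleL720Levels`
(all PROVED, no inputs; `p`-adic bookkeeping only).
`TwoTaleL720Saving.savingProduct720 n = ∏_{i<232} ∏ {p ∈ classPrimes 131044 (147·) (ivl720 i) n}` counts a prime `p`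
(`131044 n < p²`, `p ≤ 147n`) once for every interval `ivl720 i` containing `{n/p}`; `ivl720 0 … ivl720 108` are the LEVEL-1
components of `{ν ≥ 1}` and `ivl720 109 … ivl720 231` the LEVEL-2 components of `{ν = 2}` (`ν = max(φ, φ̂)`).

* `mem_classPrimes_ivl720_iff` — `p` is counted in interval `i` iff `p` prime, `p ≤ 147n`, `131044 n < p²`, `uᵢ ≤ {n/p} < vᵢ`;
* `ivlMult720 n p = #{i < 232 : p counted in i}`, **`factorization_savingProduct720`**, `savingProduct720_dvd_iff`,
  `savingProduct720_dvd_int_of_prime_pow_dvd`;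
* `lvl1_sep` / `lvl2_sep` — the intervals of one level are ordered (consecutive steps `lvl1_step` / `lvl2_step` of
  `TwoTaleL720LevelSteps` + induction), hence pairwise disjoint, so `ivlMult720 n p ≤ 2`;
* **`prime_pow_ivlMult720_dvd_of_levels`**, **`savingProduct720_dvd_of_levels`**, `savingProduct720_dvd_of_unpacked`
  (level-1 divisibilities `p ∣ M` and level-2 divisibilities `p² ∣ M` give `Φₙ ∣ M`);
* **`inclusionL720_of_levels`**: the same for `M = qₙ` and for an integer `Z = D₁₄₇ₙD₁₅₄ₙ pₙ` prove
  `TwoTaleL720Exponent.InclusionL720`.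
The per-interval divisibilities themselves come from the digit tables (`Denom.DigitCover`,
`Denom.TwoTaleL720DigitTables`) in `Denom.TwoTaleL720Inclusion`.
-/

noncomputable section

open Finset
open Literature.NumberTheory.DiophantineApproximation.RhinViola
open Summit.KontsevichZagierPeriods.Zeta5Search.Denom.TwoTaleL720Saving
open Summit.KontsevichZagierPeriods.Zeta5Search.Denom.TwoTaleL720Forms
open Summit.KontsevichZagierPeriods.Zeta5Search.Denom.TwoTaleL720Exponent
open Summit.KontsevichZagierPeriods.Zeta5Search.Denom.TwoTaleL720LevelSteps

namespace Summit.KontsevichZagierPeriods.Zeta5Search.Denom.TwoTaleL720Levels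

/-! ### Membership and the plain product -/

/-- A prime `p` is counted in the digit interval `ivl720 i = [uᵢ, vᵢ)` at `n` iff `p ≤ 147n`, `131044 n < p²` and
`uᵢ ≤ {n/p} < vᵢ`. -/
theorem mem_classPrimes_ivl720_iff {i n p : ℕ} :
    p ∈ classPrimes 131044 primeCut720 (ivl720 i) n ↔
      p.Prime ∧ p ≤ 147 * n ∧ (131044 : ℝ) * n < (p : ℝ) ^ 2 ∧
        (ivl720 i).1 ≤ Int.fract ((n : ℝ) / p) ∧ Int.fract ((n : ℝ) / p) < (ivl720 i).2 := by
  simp only [classPrimes, primeCut720, mem_filter, mem_range]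
  constructor
  · rintro ⟨h1, h2, h3, h4, h5⟩
    exact ⟨h2, by omega, h3, h4, h5⟩
  · rintro ⟨h2, h1, h3, h4, h5⟩
    exact ⟨by omega, h2, h3, h4, h5⟩

/-- `131044 n < p²` over `ℝ` iff over `ℕ`. -/
theorem cast_lt_sq_iff {n p : ℕ} : (131044 : ℝ) * n < (p : ℝ) ^ 2 ↔ 131044 * n < p ^ 2 := by
  constructor
  · intro h; exact_mod_cast h
  · intro h; exact_mod_cast h

/-- A counted prime satisfies the hypotheses of the per-interval divisibility theorems. -/
theorem hyps_of_mem_classPrimes_ivl720 {i n p : ℕ} (h : p ∈ classPrimes 131044 primeCut720 (ivl720 i) n) :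
    p.Prime ∧ p ≤ 147 * n ∧ 131044 * n < p ^ 2 ∧
      (ivl720 i).1 ≤ Int.fract ((n : ℝ) / p) ∧ Int.fract ((n : ℝ) / p) < (ivl720 i).2 := by
  obtain ⟨hp, hle, h2, h3, h4⟩ := mem_classPrimes_ivl720_iff.1 h
  exact ⟨hp, hle, cast_lt_sq_iff.1 h2, h3, h4⟩

/-- `ivlProduct720 i n` is the plain product of the primes of class `i`. -/
theorem ivlProduct720_eq (i n : ℕ) : ivlProduct720 i n = ∏ p ∈ classPrimes 131044 primeCut720 (ivl720 i) n, p := by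
  simp [ivlProduct720, classPrimeProduct, Finset.singleton_biUnion]

/-- **Multiplicity of `p` in `Φₙ`**: the number of the 232 digit intervals whose class contains `p`
(`= ν(n/p)` for a prime `p ≤ 147n`, `p² > 131044 n`; `0` otherwise). -/
def ivlMult720 (n p : ℕ) : ℕ := ((range 232).filter fun i => p ∈ classPrimes 131044 primeCut720 (ivl720 i) n).card

/-- A non-prime has multiplicity `0`. -/
theorem ivlMult720_eq_zero_of_not_prime {n p : ℕ} (hp : ¬ p.Prime) : ivlMult720 n p = 0 := by
  rw [ivlMult720, card_eq_zero, filter_eq_empty_iff]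
  intro i _ h
  exact hp (prime_of_mem_classPrimes h)

/-! ### Factorization of `Φₙ` -/

/-- `v_p` of one class product: `1` if `p` is in the class, else `0`. -/
theorem factorization_ivlProduct720 (i n p : ℕ) :
    (ivlProduct720 i n).factorization p = if p ∈ classPrimes 131044 primeCut720 (ivl720 i) n then 1 else 0 := by
  rw [ivlProduct720_eq, Nat.factorization_prod fun q hq => (prime_of_mem_classPrimes hq).ne_zero,
    Finsupp.finsetSum_apply]
  have h : ∀ q ∈ classPrimes 131044 primeCut720 (ivl720 i) n, q.factorization p = if q = p then 1 else 0 :=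
    fun q hq => by rw [(prime_of_mem_classPrimes hq).factorization, Finsupp.single_apply]
  rw [sum_congr rfl h, sum_ite_eq']

/-- **`(Φₙ).factorization p = ivlMult720 n p`.** -/
theorem factorization_savingProduct720 (n p : ℕ) : (savingProduct720 n).factorization p = ivlMult720 n p := by
  rw [savingProduct720, Nat.factorization_prod fun i _ => (ivlProduct720_pos i n).ne', Finsupp.finsetSum_apply]
  simp_rw [factorization_ivlProduct720]
  rw [ivlMult720, card_filter]

/-- `v_p(Φₙ) = ivlMult720 n p` for a prime `p`. -/
theorem padicValNat_savingProduct720 {n p : ℕ} (hp : p.Prime) :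
    padicValNat p (savingProduct720 n) = ivlMult720 n p := by
  rw [← Nat.factorization_def _ hp, factorization_savingProduct720]

/-! ### Divisibility criteria -/

/-- **`Φₙ ∣ M ↔ ∀ p prime, ivlMult720 n p ≤ v_p(M)`** (`M ≠ 0`). -/
theorem savingProduct720_dvd_iff {n M : ℕ} (hM : M ≠ 0) :
    savingProduct720 n ∣ M ↔ ∀ p : ℕ, p.Prime → ivlMult720 n p ≤ padicValNat p M := by
  rw [← Nat.factorization_le_iff_dvd (savingProduct720_pos n).ne' hM, Finsupp.le_def]
  constructor
  · intro h p hp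
    have h' := h p
    rwa [factorization_savingProduct720, Nat.factorization_def _ hp] at h'
  · intro h p
    by_cases hp : p.Prime
    · rw [factorization_savingProduct720, Nat.factorization_def _ hp]; exact h p hp
    · rw [Nat.factorization_eq_zero_of_not_prime _ hp]; exact Nat.zero_le _

/-- The same over `ℤ`: `Φₙ ∣ z ↔ ∀ p prime, ivlMult720 n p ≤ v_p(z)` (`z ≠ 0`). -/
theorem savingProduct720_dvd_int_iff {n : ℕ} {z : ℤ} (hz : z ≠ 0) :
    (savingProduct720 n : ℤ) ∣ z ↔ ∀ p : ℕ, p.Prime → ivlMult720 n p ≤ padicValInt p z := by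
  rw [Int.natCast_dvd, savingProduct720_dvd_iff (Int.natAbs_ne_zero.2 hz)]
  simp only [padicValInt]

/-- **Prime powers suffice:** if `p ^ ivlMult720 n p ∣ z` for every prime `p`, then `Φₙ ∣ z`. -/
theorem savingProduct720_dvd_int_of_prime_pow_dvd {n : ℕ} {z : ℤ}
    (h : ∀ p : ℕ, p.Prime → (p : ℤ) ^ ivlMult720 n p ∣ z) : (savingProduct720 n : ℤ) ∣ z := by
  rcases eq_or_ne z 0 with rfl | hz
  · exact dvd_zero _
  rw [savingProduct720_dvd_int_iff hz]
  intro p hp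
  haveI := Fact.mk hp
  exact ((padicValInt_dvd_iff _ _).1 (h p hp)).resolve_left hz

/-! ### The intervals of one level are pairwise disjoint -/

/-- Ordered separation of the level-1 intervals: `vᵢ ≤ uⱼ` for `i < j < 109`. -/
theorem lvl1_sep {i j : ℕ} (hij : i < j) (hj : j < 109) : (ivl720 i).2 ≤ (ivl720 j).1 := by
  induction j with
  | zero => omega
  | succ k ih =>
    rcases Nat.lt_succ_iff_lt_or_eq.1 hij with h | h
    · exact (ih h (by omega)).trans (((ivl720_lt k).le).trans (lvl1_step k hj))
    · subst h; exact lvl1_step i hj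

/-- Ordered separation of the level-2 intervals: `vᵢ ≤ uⱼ` for `109 ≤ i < j < 232`. -/
theorem lvl2_sep {i j : ℕ} (hi : 109 ≤ i) (hij : i < j) (hj : j < 232) : (ivl720 i).2 ≤ (ivl720 j).1 := by
  induction j with
  | zero => omega
  | succ k ih =>
    rcases Nat.lt_succ_iff_lt_or_eq.1 hij with h | h
    · exact (ih h (by omega)).trans (((ivl720_lt k).le).trans (lvl2_step k (by omega) hj))
    · subst h; exact lvl2_step i hi hj

/-- The 109 level-1 intervals `ivl720 0, …, ivl720 108` are pairwise disjoint. -/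
theorem lvl1_unique {x : ℝ} {i j : ℕ} (hi : i < 109) (hj : j < 109)
    (h1 : (ivl720 i).1 ≤ x) (h2 : x < (ivl720 i).2) (h3 : (ivl720 j).1 ≤ x) (h4 : x < (ivl720 j).2) : i = j := by
  by_contra hne
  rcases Nat.lt_or_gt_of_ne hne with h | h
  · have := lvl1_sep h hj; linarith
  · have := lvl1_sep h hi; linarith

/-- The 123 level-2 intervals `ivl720 109, …, ivl720 231` are pairwise disjoint. -/
theorem lvl2_unique {x : ℝ} {i j : ℕ} (hi : 109 ≤ i) (hi' : i < 232) (hj : 109 ≤ j) (hj' : j < 232)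
    (h1 : (ivl720 i).1 ≤ x) (h2 : x < (ivl720 i).2) (h3 : (ivl720 j).1 ≤ x) (h4 : x < (ivl720 j).2) : i = j := by
  by_contra hne
  rcases Nat.lt_or_gt_of_ne hne with h | h
  · have := lvl2_sep hi h hj'; linarith
  · have := lvl2_sep hj h hi'; linarith

/-- At most one level-1 interval counts a given `p`. -/
theorem card_filter_lvl1_le_one (n p : ℕ) :
    ((Ico 0 109).filter fun i => p ∈ classPrimes 131044 primeCut720 (ivl720 i) n).card ≤ 1 := by
  refine card_le_one.2 fun i hi j hj => ?_
  simp only [mem_filter, mem_Ico] at hi hj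
  obtain ⟨-, -, -, a1, a2⟩ := hyps_of_mem_classPrimes_ivl720 hi.2
  obtain ⟨-, -, -, b1, b2⟩ := hyps_of_mem_classPrimes_ivl720 hj.2
  exact lvl1_unique hi.1.2 hj.1.2 a1 a2 b1 b2

/-- At most one level-2 interval counts a given `p`. -/
theorem card_filter_lvl2_le_one (n p : ℕ) :
    ((Ico 109 232).filter fun i => p ∈ classPrimes 131044 primeCut720 (ivl720 i) n).card ≤ 1 := by
  refine card_le_one.2 fun i hi j hj => ?_
  simp only [mem_filter, mem_Ico] at hi hj
  obtain ⟨-, -, -, a1, a2⟩ := hyps_of_mem_classPrimes_ivl720 hi.2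
  obtain ⟨-, -, -, b1, b2⟩ := hyps_of_mem_classPrimes_ivl720 hj.2
  exact lvl2_unique hi.1.1 hi.1.2 hj.1.1 hj.1.2 a1 a2 b1 b2

/-- `ivlMult720` splits into its level-1 and level-2 counts. -/
theorem ivlMult720_eq_add (n p : ℕ) :
    ivlMult720 n p = ((Ico 0 109).filter fun i => p ∈ classPrimes 131044 primeCut720 (ivl720 i) n).card +
      ((Ico 109 232).filter fun i => p ∈ classPrimes 131044 primeCut720 (ivl720 i) n).card := by
  have h : range 232 = Ico 0 109 ∪ Ico 109 232 := by
    rw [range_eq_Ico, Ico_union_Ico_eq_Ico (by norm_num) (by norm_num)]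
  unfold ivlMult720
  rw [h, filter_union, card_union_of_disjoint]
  exact disjoint_filter_filter (Ico_disjoint_Ico_consecutive 0 109 232)

/-- `ν ≤ 2`: every prime is counted at most twice. -/
theorem ivlMult720_le_two (n p : ℕ) : ivlMult720 n p ≤ 2 := by
  rw [ivlMult720_eq_add]
  have := card_filter_lvl1_le_one n p
  have := card_filter_lvl2_le_one n p
  omega

/-! ### From level divisibilities to `Φₙ ∣ M` -/

/-- **Level divisibilities give `p ^ ivlMult720 n p ∣ M`.**  If `p ∣ M` whenever `p` is counted in a level-1 interval
and `p² ∣ M` whenever `p` is counted in a level-2 interval, then `p ^ ivlMult720 n p ∣ M`. -/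
theorem prime_pow_ivlMult720_dvd_of_levels {n : ℕ} {M : ℤ}
    (h1 : ∀ i < 109, ∀ p ∈ classPrimes 131044 primeCut720 (ivl720 i) n, (p : ℤ) ∣ M)
    (h2 : ∀ i, 109 ≤ i → i < 232 → ∀ p ∈ classPrimes 131044 primeCut720 (ivl720 i) n, (p : ℤ) ^ 2 ∣ M)
    (p : ℕ) : (p : ℤ) ^ ivlMult720 n p ∣ M := by
  have c1 := card_filter_lvl1_le_one n p
  rw [ivlMult720_eq_add]
  rcases ((Ico 109 232).filter fun i => p ∈ classPrimes 131044 primeCut720 (ivl720 i) n).eq_empty_or_nonempty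
    with hS | ⟨i, hi⟩
  · rw [hS, card_empty, add_zero]
    rcases ((Ico 0 109).filter fun i => p ∈ classPrimes 131044 primeCut720 (ivl720 i) n).eq_empty_or_nonempty
      with hT | ⟨j, hj⟩
    · rw [hT, card_empty, pow_zero]; exact one_dvd _
    · rw [le_antisymm c1 (card_pos.2 ⟨j, hj⟩), pow_one]
      simp only [mem_filter, mem_Ico] at hj
      exact h1 j hj.1.2 p hj.2
  · have hp2 : (p : ℤ) ^ 2 ∣ M := by
      simp only [mem_filter, mem_Ico] at hi
      exact h2 i hi.1.1 hi.1.2 p hi.2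
    refine (pow_dvd_pow _ ?_).trans hp2
    have := ivlMult720_le_two n p
    rw [ivlMult720_eq_add] at this
    exact this

/-- **`Φₙ ∣ M` from level divisibilities.** -/
theorem savingProduct720_dvd_of_levels {n : ℕ} {M : ℤ}
    (h1 : ∀ i < 109, ∀ p ∈ classPrimes 131044 primeCut720 (ivl720 i) n, (p : ℤ) ∣ M)
    (h2 : ∀ i, 109 ≤ i → i < 232 → ∀ p ∈ classPrimes 131044 primeCut720 (ivl720 i) n, (p : ℤ) ^ 2 ∣ M) :
    (savingProduct720 n : ℤ) ∣ M :=
  savingProduct720_dvd_int_of_prime_pow_dvd fun p _ => prime_pow_ivlMult720_dvd_of_levels h1 h2 p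

/-- Variant with the level divisibilities stated through the unpacked hypotheses (`p` prime, `p ≤ 147n`,
`131044 n < p²`, `uᵢ ≤ {n/p} < vᵢ`), the shape delivered by the digit tables (`Denom.DigitCover.dvd_of_cover`). -/
theorem savingProduct720_dvd_of_unpacked {n : ℕ} {M : ℤ}
    (h1 : ∀ i < 109, ∀ p : ℕ, p.Prime → p ≤ 147 * n → 131044 * n < p ^ 2 →
      (ivl720 i).1 ≤ Int.fract ((n : ℝ) / p) → Int.fract ((n : ℝ) / p) < (ivl720 i).2 → (p : ℤ) ∣ M)
    (h2 : ∀ i, 109 ≤ i → i < 232 → ∀ p : ℕ, p.Prime → p ≤ 147 * n → 131044 * n < p ^ 2 →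
      (ivl720 i).1 ≤ Int.fract ((n : ℝ) / p) → Int.fract ((n : ℝ) / p) < (ivl720 i).2 → (p : ℤ) ^ 2 ∣ M) :
    (savingProduct720 n : ℤ) ∣ M := by
  refine savingProduct720_dvd_of_levels (fun i hi p hp => ?_) fun i hi hi' p hp => ?_
  · obtain ⟨a, b, c, d, e⟩ := hyps_of_mem_classPrimes_ivl720 hp
    exact h1 i hi p a b c d e
  · obtain ⟨a, b, c, d, e⟩ := hyps_of_mem_classPrimes_ivl720 hp
    exact h2 i hi hi' p a b c d e

/-! ### The `InclusionL720` input from per-interval theorems -/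

/-- **Bridge.** Prime-power divisibility for the `q`-side and an integer witness for the `p`-side give `InclusionL720`. -/
theorem inclusionL720_of_dvd
    (hq : ∀ n : ℕ, 1 ≤ n → ∀ p : ℕ, p.Prime → (p : ℤ) ^ ivlMult720 n p ∣ ((lcmNormaliserL720 n : ℕ) : ℤ) * formQL720 n)
    (hp : ∀ n : ℕ, 1 ≤ n → ∃ A : ℤ, ((lcmNormaliserL720 n : ℕ) : ℚ) * formPL720 n = (savingProduct720 n : ℚ) * A) :
    InclusionL720 := fun n hn =>
  ⟨by obtain ⟨B, hB⟩ := savingProduct720_dvd_int_of_prime_pow_dvd (hq n hn); exact ⟨B, hB⟩, hp n hn⟩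

/-- **`InclusionL720` from unpacked level divisibilities of `qₙ` and of an integer `Z = D₁₄₇ₙD₁₅₄ₙ pₙ`** (all `n ≥ 1`):
`Φₙ ∣ D₁₄₇ₙD₁₅₄ₙ qₙ` and `Φₙ⁻¹ D₁₄₇ₙD₁₅₄ₙ pₙ ∈ ℤ`. -/
theorem inclusionL720_of_unpacked
    (hq : ∀ n, 1 ≤ n →
      (∀ i < 109, ∀ p : ℕ, p.Prime → p ≤ 147 * n → 131044 * n < p ^ 2 →
        (ivl720 i).1 ≤ Int.fract ((n : ℝ) / p) → Int.fract ((n : ℝ) / p) < (ivl720 i).2 → (p : ℤ) ∣ formQL720 n) ∧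
      (∀ i, 109 ≤ i → i < 232 → ∀ p : ℕ, p.Prime → p ≤ 147 * n → 131044 * n < p ^ 2 →
        (ivl720 i).1 ≤ Int.fract ((n : ℝ) / p) → Int.fract ((n : ℝ) / p) < (ivl720 i).2 → (p : ℤ) ^ 2 ∣ formQL720 n))
    (hp : ∀ n, 1 ≤ n → ∃ Z : ℤ, ((lcmNormaliserL720 n : ℕ) : ℚ) * formPL720 n = Z ∧
      (∀ i < 109, ∀ p : ℕ, p.Prime → p ≤ 147 * n → 131044 * n < p ^ 2 →
        (ivl720 i).1 ≤ Int.fract ((n : ℝ) / p) → Int.fract ((n : ℝ) / p) < (ivl720 i).2 → (p : ℤ) ∣ Z) ∧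
      (∀ i, 109 ≤ i → i < 232 → ∀ p : ℕ, p.Prime → p ≤ 147 * n → 131044 * n < p ^ 2 →
        (ivl720 i).1 ≤ Int.fract ((n : ℝ) / p) → Int.fract ((n : ℝ) / p) < (ivl720 i).2 → (p : ℤ) ^ 2 ∣ Z)) :
    InclusionL720 := by
  intro n hn
  obtain ⟨hq1, hq2⟩ := hq n hn
  obtain ⟨Z, hZ, hz1, hz2⟩ := hp n hn
  refine ⟨?_, ?_⟩
  · obtain ⟨B, hB⟩ := savingProduct720_dvd_of_unpacked hq1 hq2
    exact ⟨((lcmNormaliserL720 n : ℕ) : ℤ) * B, by rw [hB]; ring⟩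
  · obtain ⟨A, hA⟩ := savingProduct720_dvd_of_unpacked hz1 hz2
    exact ⟨A, by rw [hZ, hA]; push_cast; ring⟩

end Summit.KontsevichZagierPeriods.Zeta5Search.Denom.TwoTaleL720Levels

end
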